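import Mathlib

/-!
# Emergence bootstrap: the continuous-induction lemma behind «linear ⇒ nonlinear instability» and two exact constants (instab g8, cell `ns-blowup`, 2026-08-25)

HONEST FRAMING (human ruling D-0035): nothing here is a claim about Navier–Stokes blow-up.
WHAT THIS IS NOT: not NS evidence. These are the kernel-checkable pieces of `instab/INSTAB-BRIDGE.md`
§10 (R-β «rope emergence»): the abstract bootstrap of Friedlander–Pavlović–Shvydkoy, *Nonlinear
instability for the Navier–Stokes equations*, Comm. Math. Phys. 264 (2006), Lemmas 3.3–3.4 (there
`f(t) = ‖v(t)‖`, `a(t) = ε e^{λt}`, and the Duhamel estimate `‖B(t)‖ ≤ C (Q ε e^{λt})²` valid as long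
as `‖v‖ ≤ Q ε e^{λ·}` on `[0, t]`), written as a statement about two real functions on an interval, plus
two exact constants of §10 l.99 (the numerical-range parabola of the linearised operator and the
weight integral in the Helffer–Sjöstrand quantitative Gearhart–Prüss bound).

* `le_mul_of_bootstrap` (K-B8) — CONTINUOUS INDUCTION: if `f, a` are continuous on `[0, T]`,
  `f 0 ≤ Q·a 0`, the a-priori bound `f ≤ Q·a on [0, t]` always IMPROVES itself to
  `f t ≤ a t + C (Q a t)²`, and `a > 0`, `C Q² a < Q − 1` on `[0, T]` (i.e. `a` stays below the
  threshold `χ = (Q − 1)/(C Q²)`), then `f ≤ Q·a` on all of `[0, T]` — hence (`lt_mul_of_bootstrap`)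
  even `f t ≤ a t + C (Q a t)² < Q·a t`. Proof: first exit time `τ = inf {t : Q a t < f t}`; the bound
  holds on `[0, τ]` by minimality and closedness, improves strictly at `τ`, and persists past `τ` by
  continuity — contradiction.
* `re_le_parabola` — the numerical-range arithmetic of §10 l.99: from `x ≤ √2 − ν g²` (dissipation vs.
  the exact strain bound `s = √2`) and `|y| ≤ √6·g + √3` (`sup|U| = √6`, `‖∇U‖_op ≤ √3` for
  `U = abc(1,1,1)`) one gets, for `|y| ≥ √3`, `x ≤ √2 − ν (|y| − √3)²/6`: the numerical range of the
  linearisation lies inside a left-opening parabola, so the resolvent is `≤ 1` far up the line `Re z = ω`.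
* `weight_integral` — `∫₀¹ e^{2(ω − ω̂)s} ds = (1 − e^{−2(ω̂ − ω)})/(2(ω̂ − ω))` for `ω ≠ ω̂`, the
  weight norm `‖1/m‖²` with `m(t) = e^{ω̂ t}` in Helffer, *Spectral Theory and its Applications* (2013),
  Thm 13.30 / (13.5.11), giving `M_ω ≤ max(e^{2(ω̂−ω)}, 2(ω̂−ω)/((1 − e^{−2(ω̂−ω)}) r(ω)))`.
* (appended v2, instab g11, 2026-08-26) `integral_rpow_neg_half_mul_exp_Ioi`
  (`∫₀^∞ r^{−1/2} e^{−κr} dr = √(π/κ)`), `integral_rpow_neg_half_mul_exp_le`, `duhamel_kernel_le`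
  (`∫₀ᵗ (t−s)^{−1/2} e^{ω(t−s)} e^{2λs} ds ≤ √(π/(2λ−ω)) e^{2λt}` for `2λ > ω`) and `duhamel_term_le`
  — the Duhamel constant `C = S·c·√(π/(2λ−ω))` of §10 l.98 (A22) / §11 l.111: the smoothing profile
  `S τ^{−1/2} e^{ωτ}` carries a nonlinearity of size `c (Q ε e^{λs})²` to at most `C (Q ε e^{λt})²`,
  which is the hypothesis `hboot` of `le_mul_of_bootstrap`.
* (appended v3) `floor_of_bootstrap`, `half_prediction_le` — R-β's AMPLITUDE FLOOR AND CLOCK: if the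
  deviation from the linear prediction is self-improvingly small, `|f − a| ≤ C (Q a)²` while
  `f ≤ Q a`, then `a (1 − C Q² a) ≤ f ≤ a + C (Q a)²` on the whole window, and with `Q = 3/2` the
  perturbation is at least `a/2` wherever `a ≤ χ* = 2/(9C)`: it reaches `χ*/2` no later than the
  linear clock `t* = λ⁻¹ log(χ*/ε)`.

Mathlib only; no new definitions.
-/

namespace Summit.NavierStokesRegularity.FluidComputer.EmergenceBootstrap

open Set

section Bootstrap

/-- **K-B8 (continuous induction / the FPS bootstrap, Lemmas 3.3–3.4 of Friedlander–Pavlović–Shvydkoy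
2006 in abstract form).** Let `f a : ℝ → ℝ` be continuous on `[0, T]` with `f 0 ≤ Q·a 0`. Suppose the
a-priori bound improves itself — for every `t ∈ [0, T]`, `(∀ s ∈ [0, t], f s ≤ Q·a s) → f t ≤ a t +
C·(Q·a t)²` — and that on `[0, T]` the comparison function is positive and below threshold,
`0 < a t` and `C·Q²·a t < Q − 1`. Then `f t ≤ Q·a t` for every `t ∈ [0, T]`. -/
theorem le_mul_of_bootstrap {f a : ℝ → ℝ} {T Q C : ℝ}
    (hf : ContinuousOn f (Icc 0 T)) (ha : ContinuousOn a (Icc 0 T))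
    (h0 : f 0 ≤ Q * a 0)
    (hboot : ∀ t ∈ Icc 0 T, (∀ s ∈ Icc 0 t, f s ≤ Q * a s) → f t ≤ a t + C * (Q * a t) ^ 2)
    (hsmall : ∀ t ∈ Icc 0 T, 0 < a t ∧ C * Q ^ 2 * a t < Q - 1) :
    ∀ t ∈ Icc 0 T, f t ≤ Q * a t := by
  by_contra hcon
  push Not at hcon
  obtain ⟨t₁, ht₁, hbad⟩ := hcon
  -- the bad set and its infimum (first exit time)
  set B : Set ℝ := {t | t ∈ Icc 0 T ∧ Q * a t < f t} with hB
  have hne : B.Nonempty := ⟨t₁, ht₁, hbad⟩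
  have hbdd : BddBelow B := ⟨0, fun b hb => hb.1.1⟩
  set τ := sInf B with hτ
  have hτ0 : 0 ≤ τ := le_csInf hne (fun b hb => hb.1.1)
  have hτt₁ : τ ≤ t₁ := csInf_le hbdd ⟨ht₁, hbad⟩
  have hτT : τ ≤ T := hτt₁.trans ht₁.2
  have hτI : τ ∈ Icc 0 T := ⟨hτ0, hτT⟩
  -- below τ the bound holds
  have hbelow : ∀ s ∈ Ico 0 τ, f s ≤ Q * a s := by
    intro s hs
    by_contra hs'
    push Not at hs'
    have hsB : s ∈ B := ⟨⟨hs.1, (le_of_lt hs.2).trans hτT⟩, hs'⟩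
    exact (not_le.mpr hs.2) (csInf_le hbdd hsB)
  -- continuity of g := Q a − f within [0, T]
  have hg : ContinuousOn (fun s => Q * a s - f s) (Icc 0 T) := (ha.const_smul Q |>.sub hf).congr
    (by intro s _; simp [smul_eq_mul])
  -- at τ the bound holds (closedness)
  have hatτ : f τ ≤ Q * a τ := by
    rcases eq_or_lt_of_le hτ0 with h | h
    · rw [← h]; exact h0
    · have hclos : τ ∈ closure (Ico 0 τ) := by
        rw [closure_Ico h.ne]; exact right_mem_Icc.mpr h.le
      have hsub : Ico 0 τ ⊆ Icc 0 T := fun s hs => ⟨hs.1, (le_of_lt hs.2).trans hτT⟩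
      have hfc : ContinuousWithinAt f (Ico 0 τ) τ := (hf τ hτI).mono hsub
      have hgc : ContinuousWithinAt (fun s => Q * a s) (Ico 0 τ) τ :=
        ((ha τ hτI).mono hsub).const_smul Q |>.congr (fun s _ => by simp [smul_eq_mul])
          (by simp [smul_eq_mul])
      exact hfc.closure_le hclos hgc hbelow
  -- hence on all of [0, τ], and the bound improves strictly at τ
  have hIcc : ∀ s ∈ Icc 0 τ, f s ≤ Q * a s := by
    intro s hs
    rcases eq_or_lt_of_le hs.2 with h | h
    · rw [h]; exact hatτ
    · exact hbelow s ⟨hs.1, h⟩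
  have himp := hboot τ hτI hIcc
  obtain ⟨hapos, hthr⟩ := hsmall τ hτI
  have hstrict : f τ < Q * a τ := by
    have : C * (Q * a τ) ^ 2 < (Q - 1) * a τ := by
      have : C * (Q * a τ) ^ 2 = (C * Q ^ 2 * a τ) * a τ := by ring
      rw [this]
      exact mul_lt_mul_of_pos_right hthr hapos
    linarith
  -- persistence past τ by continuity within [0, T]
  have hev : ∀ᶠ s in nhdsWithin τ (Icc 0 T), 0 < Q * a s - f s := by
    have hcont : ContinuousWithinAt (fun s => Q * a s - f s) (Icc 0 T) τ := hg τ hτI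
    exact hcont.eventually (Ioi_mem_nhds (by linarith))
  obtain ⟨δ, hδpos, hδ⟩ := Metric.mem_nhdsWithin_iff.mp hev
  -- an element of B in [τ, τ + δ)
  have hlt : sInf B < τ + δ := by linarith
  obtain ⟨b, hbB, hbδ⟩ := exists_lt_of_csInf_lt hne hlt
  have hτb : τ ≤ b := csInf_le hbdd hbB
  have hbball : b ∈ Metric.ball τ δ ∩ Icc 0 T := by
    refine ⟨?_, hbB.1⟩
    rw [Metric.mem_ball, Real.dist_eq, abs_of_nonneg (by linarith)]
    linarith
  have hgood : 0 < Q * a b - f b := hδ hbball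
  exact absurd hbB.2 (by linarith)

/-- **K-B8, emergence form.** Under the hypotheses of `le_mul_of_bootstrap`, at every `t ∈ [0, T]` the
improved bound holds and is STRICTLY inside the a-priori one: `f t ≤ a t + C (Q a t)² < Q·a t`. In
§10 (R-β) with `Q = 3/2` and `a(t*) = χ* = 2/(9C)` this is `‖B(t*)‖ ≤ χ*/2`: the solution is the rope
`χ*·V` up to a 50 % correction. -/
theorem lt_mul_of_bootstrap {f a : ℝ → ℝ} {T Q C : ℝ}
    (hf : ContinuousOn f (Icc 0 T)) (ha : ContinuousOn a (Icc 0 T))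
    (h0 : f 0 ≤ Q * a 0)
    (hboot : ∀ t ∈ Icc 0 T, (∀ s ∈ Icc 0 t, f s ≤ Q * a s) → f t ≤ a t + C * (Q * a t) ^ 2)
    (hsmall : ∀ t ∈ Icc 0 T, 0 < a t ∧ C * Q ^ 2 * a t < Q - 1) :
    ∀ t ∈ Icc 0 T, f t ≤ a t + C * (Q * a t) ^ 2 ∧ a t + C * (Q * a t) ^ 2 < Q * a t := by
  intro t ht
  have hall := le_mul_of_bootstrap hf ha h0 hboot hsmall
  refine ⟨hboot t ht (fun s hs => hall s ⟨hs.1, hs.2.trans ht.2⟩), ?_⟩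
  obtain ⟨hapos, hthr⟩ := hsmall t ht
  have : C * (Q * a t) ^ 2 = (C * Q ^ 2 * a t) * a t := by ring
  rw [this]
  nlinarith [mul_lt_mul_of_pos_right hthr hapos]

/-- The threshold arithmetic of §10 (s4): with `Q = 3/2` and `χ = 2/(9C)` (`C > 0`) one has
`C·Q²·χ = 1/2 = Q − 1` exactly and `C·(Q χ)² = χ/2` — so any `a < χ` is admissible in K-B8 and the
correction at amplitude `χ` is one half of it. -/
theorem threshold_three_halves {C : ℝ} (hC : 0 < C) :
    C * (3 / 2 : ℝ) ^ 2 * (2 / (9 * C)) = 3 / 2 - 1 ∧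
      C * ((3 / 2 : ℝ) * (2 / (9 * C))) ^ 2 = (2 / (9 * C)) / 2 := by
  constructor
  · field_simp; ring
  · field_simp; ring

end Bootstrap

section Constants

/-- **Numerical-range parabola (§10 l.99, EXACT).** If `x ≤ √2 − ν g²` and `|y| ≤ √6·g + √3` with
`ν ≥ 0` and `√3 ≤ |y|`, then `x ≤ √2 − ν (|y| − √3)²/6`. (For the linearisation `A` of forced
NS about `U = abc(1,1,1)` at `ν`: `x + iy = ⟨Av, v⟩` with `‖v‖ = 1`, `g = ‖∇v‖`, using the exact
constants `s = √2`, `sup|U| = √6`, `‖∇U‖_op ≤ √3`.) -/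
theorem re_le_parabola {x y g ν : ℝ} (hν : 0 ≤ ν)
    (hx : x ≤ Real.sqrt 2 - ν * g ^ 2) (hy : |y| ≤ Real.sqrt 6 * g + Real.sqrt 3)
    (hy3 : Real.sqrt 3 ≤ |y|) :
    x ≤ Real.sqrt 2 - ν * (|y| - Real.sqrt 3) ^ 2 / 6 := by
  have h6 : Real.sqrt 6 ^ 2 = 6 := Real.sq_sqrt (by norm_num)
  have hs6 : 0 ≤ Real.sqrt 6 := Real.sqrt_nonneg 6
  have h1 : |y| - Real.sqrt 3 ≤ Real.sqrt 6 * g := by linarith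
  have h0 : 0 ≤ |y| - Real.sqrt 3 := by linarith
  have h2 : (|y| - Real.sqrt 3) ^ 2 ≤ 6 * g ^ 2 := by
    calc (|y| - Real.sqrt 3) ^ 2 ≤ (Real.sqrt 6 * g) ^ 2 := by
          exact pow_le_pow_left₀ h0 h1 2
      _ = 6 * g ^ 2 := by rw [mul_pow, h6]
  have h3 : ν * (|y| - Real.sqrt 3) ^ 2 / 6 ≤ ν * g ^ 2 := by
    have := mul_le_mul_of_nonneg_left h2 hν
    linarith
  linarith

/-- **Weight integral in the Helffer–Sjöstrand bound (§10 l.99 (c), EXACT).** For `ω ≠ ω̂`,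
`∫₀¹ e^{2(ω − ω̂)s} ds = (1 − e^{−2(ω̂ − ω)}) / (2(ω̂ − ω))`. -/
theorem weight_integral {ω ωh : ℝ} (h : ω ≠ ωh) :
    ∫ s in (0:ℝ)..1, Real.exp (2 * (ω - ωh) * s) = (1 - Real.exp (-(2 * (ωh - ω)))) / (2 * (ωh - ω)) := by
  have hc : (2 * (ω - ωh)) ≠ 0 := by
    intro h0; apply h; linarith
  have key : ∫ s in (0:ℝ)..1, Real.exp (2 * (ω - ωh) * s)
      = (Real.exp (2 * (ω - ωh) * 1) - Real.exp (2 * (ω - ωh) * 0)) / (2 * (ω - ωh)) := by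
    rw [intervalIntegral.integral_comp_mul_left (fun s => Real.exp s) hc, integral_exp]
    simp [smul_eq_mul]
    field_simp
  rw [key]
  have e1 : 2 * (ω - ωh) * 1 = -(2 * (ωh - ω)) := by ring
  rw [e1, mul_zero, Real.exp_zero]
  have hc' : (2 * (ωh - ω)) ≠ 0 := by intro h0; apply h; linarith
  field_simp
  ring

end Constants

section DuhamelKernel

open MeasureTheory

/-- **The smoothing kernel has total mass `√(π/κ)` (§10 l.99 / §11 l.111: the `(2λ* − ω)^{−1/2}`
factor of the Duhamel constant).** For `κ > 0`:
`∫_{(0,∞)} r^{−1/2} e^{−κ r} dr = √(π/κ)` (`= κ^{−1/2} Γ(½)`). -/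
theorem integral_rpow_neg_half_mul_exp_Ioi {κ : ℝ} (hκ : 0 < κ) :
    ∫ r in Ioi (0:ℝ), r ^ (-(1 / 2 : ℝ)) * Real.exp (-(κ * r)) = Real.sqrt (Real.pi / κ) := by
  have h := Real.integral_rpow_mul_exp_neg_mul_Ioi (a := 1 / 2) (r := κ) one_half_pos hκ
  have e : (1 / 2 : ℝ) - 1 = -(1 / 2 : ℝ) := by norm_num
  rw [e] at h
  rw [h, Real.Gamma_one_half_eq, Real.sqrt_eq_rpow, Real.sqrt_eq_rpow,
    Real.div_rpow Real.pi_pos.le hκ.le, one_div]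
  rw [Real.inv_rpow hκ.le]
  ring

/-- The kernel `r ↦ r^{−1/2} e^{−κ r}` is integrable on `(0, ∞)` for `κ > 0`. -/
theorem integrableOn_rpow_neg_half_mul_exp_Ioi {κ : ℝ} (hκ : 0 < κ) :
    IntegrableOn (fun r : ℝ => r ^ (-(1 / 2 : ℝ)) * Real.exp (-(κ * r))) (Ioi 0) := by
  refine Integrable.of_integral_ne_zero ?_
  rw [integral_rpow_neg_half_mul_exp_Ioi hκ]
  exact (Real.sqrt_pos.2 (div_pos Real.pi_pos hκ)).ne'

/-- **Truncated kernel mass.** For `κ > 0` and `t ≥ 0`: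
`∫₀ᵗ r^{−1/2} e^{−κ r} dr ≤ √(π/κ)`. -/
theorem integral_rpow_neg_half_mul_exp_le {κ t : ℝ} (hκ : 0 < κ) (ht : 0 ≤ t) :
    ∫ r in (0:ℝ)..t, r ^ (-(1 / 2 : ℝ)) * Real.exp (-(κ * r)) ≤ Real.sqrt (Real.pi / κ) := by
  rw [intervalIntegral.integral_of_le ht, ← integral_rpow_neg_half_mul_exp_Ioi hκ]
  refine setIntegral_mono_set (integrableOn_rpow_neg_half_mul_exp_Ioi hκ) ?_
    Ioc_subset_Ioi_self.eventuallyLE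
  · filter_upwards [ae_restrict_mem measurableSet_Ioi] with r hr
    exact mul_nonneg (Real.rpow_nonneg hr.out.le _) (Real.exp_pos _).le

/-- **The Duhamel convolution bound of the FPS bootstrap (§10 l.98–99, the constant `C`).** If
`2λ > ω`, then for `t ≥ 0`:
`∫₀ᵗ (t − s)^{−1/2} e^{ω(t−s)} e^{2λ s} ds ≤ √(π/(2λ − ω)) · e^{2λ t}` — i.e. a perturbation
growing like `(ε e^{λs})²` is carried by the smoothing kernel `S (t−s)^{−1/2} e^{ω(t−s)}` to at
most `S √(π/(2λ−ω)) (ε e^{λt})²`, the self-improving bound `f t ≤ a t + C (Q a t)²` of K-B8. -/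
theorem duhamel_kernel_le {lam ω t : ℝ} (hgap : ω < 2 * lam) (ht : 0 ≤ t) :
    ∫ s in (0:ℝ)..t, (t - s) ^ (-(1 / 2 : ℝ)) * Real.exp (ω * (t - s)) * Real.exp (2 * lam * s)
      ≤ Real.sqrt (Real.pi / (2 * lam - ω)) * Real.exp (2 * lam * t) := by
  set κ := 2 * lam - ω with hκdef
  have hκ : 0 < κ := by rw [hκdef]; linarith
  -- substitute `s ↦ t - s`
  have hsub : ∫ s in (0:ℝ)..t, (t - s) ^ (-(1 / 2 : ℝ)) * Real.exp (ω * (t - s)) *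
      Real.exp (2 * lam * s) = ∫ r in (0:ℝ)..t, r ^ (-(1 / 2 : ℝ)) * Real.exp (ω * r) *
      Real.exp (2 * lam * (t - r)) := by
    have := intervalIntegral.integral_comp_sub_left
      (fun r => r ^ (-(1 / 2 : ℝ)) * Real.exp (ω * r) * Real.exp (2 * lam * (t - r))) t
      (a := 0) (b := t)
    simp only [sub_sub_cancel, sub_self, sub_zero] at this
    rw [this]
  rw [hsub]
  have hpt : ∀ r : ℝ, r ^ (-(1 / 2 : ℝ)) * Real.exp (ω * r) * Real.exp (2 * lam * (t - r)) =
      Real.exp (2 * lam * t) * (r ^ (-(1 / 2 : ℝ)) * Real.exp (-(κ * r))) := by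
    intro r
    have : Real.exp (ω * r) * Real.exp (2 * lam * (t - r)) =
        Real.exp (2 * lam * t) * Real.exp (-(κ * r)) := by
      rw [← Real.exp_add, ← Real.exp_add]; congr 1; rw [hκdef]; ring
    calc r ^ (-(1 / 2 : ℝ)) * Real.exp (ω * r) * Real.exp (2 * lam * (t - r))
        = r ^ (-(1 / 2 : ℝ)) * (Real.exp (ω * r) * Real.exp (2 * lam * (t - r))) := by ring
      _ = Real.exp (2 * lam * t) * (r ^ (-(1 / 2 : ℝ)) * Real.exp (-(κ * r))) := by
          rw [this]; ring
  simp_rw [hpt]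
  rw [intervalIntegral.integral_const_mul]
  have h1 := integral_rpow_neg_half_mul_exp_le hκ ht
  have h2 : 0 < Real.exp (2 * lam * t) := Real.exp_pos _
  nlinarith

/-- **The Duhamel constant (§10 l.98 A22 / §11 l.111).** With the certified smoothing profile
`‖e^{τA}‖_{1→2} ≤ S τ^{−1/2} e^{ωτ}` (`S ≥ 0`), a bilinear bound of size `c ≥ 0`, and the
a-priori growth `(Q ε e^{λ s})²` of the nonlinearity, the Duhamel term is at most
`C · (Q ε e^{λ t})²` with `C = S · c · √(π/(2λ − ω))`, for every `t ≥ 0`, provided `2λ > ω`. -/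
theorem duhamel_term_le {S c Q ε lam ω t : ℝ} (hS : 0 ≤ S) (hc : 0 ≤ c) (hgap : ω < 2 * lam)
    (ht : 0 ≤ t) :
    ∫ s in (0:ℝ)..t, S * (t - s) ^ (-(1 / 2 : ℝ)) * Real.exp (ω * (t - s)) *
        (c * (Q * ε * Real.exp (lam * s)) ^ 2)
      ≤ S * c * Real.sqrt (Real.pi / (2 * lam - ω)) * (Q * ε * Real.exp (lam * t)) ^ 2 := by
  have hpt : ∀ s : ℝ, S * (t - s) ^ (-(1 / 2 : ℝ)) * Real.exp (ω * (t - s)) *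
      (c * (Q * ε * Real.exp (lam * s)) ^ 2) = S * c * (Q * ε) ^ 2 *
      ((t - s) ^ (-(1 / 2 : ℝ)) * Real.exp (ω * (t - s)) * Real.exp (2 * lam * s)) := by
    intro s
    have : Real.exp (lam * s) ^ 2 = Real.exp (2 * lam * s) := by
      rw [sq, ← Real.exp_add]; ring_nf
    rw [mul_pow, this]; ring
  simp_rw [hpt]
  rw [intervalIntegral.integral_const_mul]
  have h1 := duhamel_kernel_le hgap ht
  have h2 : 0 ≤ S * c * (Q * ε) ^ 2 := by positivity
  have h3 : Real.exp (lam * t) ^ 2 = Real.exp (2 * lam * t) := by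
    rw [sq, ← Real.exp_add]; ring_nf
  calc S * c * (Q * ε) ^ 2 * ∫ s in (0:ℝ)..t, (t - s) ^ (-(1 / 2 : ℝ)) * Real.exp (ω * (t - s)) *
        Real.exp (2 * lam * s)
      ≤ S * c * (Q * ε) ^ 2 * (Real.sqrt (Real.pi / (2 * lam - ω)) * Real.exp (2 * lam * t)) :=
        mul_le_mul_of_nonneg_left h1 h2
    _ = S * c * Real.sqrt (Real.pi / (2 * lam - ω)) * (Q * ε * Real.exp (lam * t)) ^ 2 := by
        have h4 : (Q * ε * Real.exp (lam * t)) ^ 2 = (Q * ε) ^ 2 * Real.exp (2 * lam * t) := by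
          rw [mul_pow, h3]
        rw [h4]; ring

end DuhamelKernel

section Floor

/-- **R-β's amplitude floor (§10 l.98, CLAIM A22: «rope emergence with an amplitude floor and a
clock»).** Let `f` (the perturbation norm) and `a` (the linear prediction `ε e^{λt}`) be continuous
on `[0, T]` with `f 0 ≤ Q·a 0`, and suppose the DEVIATION from the linear prediction is
self-improvingly small: whenever `f ≤ Q·a` on `[0, t]`, `|f t − a t| ≤ C·(Q·a t)²` (Duhamel bound,
`duhamel_term_le`). If on `[0, T]` the prediction stays positive and below threshold,
`0 < a t` and `C·Q²·a t < Q − 1`, then on all of `[0, T]` the perturbation is squeezed between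
`a t − C (Q a t)²` and `a t + C (Q a t)²`; in particular `f t ≥ a t · (1 − C·Q²·a t)`. -/
theorem floor_of_bootstrap {f a : ℝ → ℝ} {T Q C : ℝ}
    (hf : ContinuousOn f (Icc 0 T)) (ha : ContinuousOn a (Icc 0 T))
    (h0 : f 0 ≤ Q * a 0)
    (hdev : ∀ t ∈ Icc 0 T, (∀ s ∈ Icc 0 t, f s ≤ Q * a s) → |f t - a t| ≤ C * (Q * a t) ^ 2)
    (hsmall : ∀ t ∈ Icc 0 T, 0 < a t ∧ C * Q ^ 2 * a t < Q - 1) :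
    ∀ t ∈ Icc 0 T, a t * (1 - C * Q ^ 2 * a t) ≤ f t ∧ f t ≤ a t + C * (Q * a t) ^ 2 := by
  have hup := le_mul_of_bootstrap hf ha h0
    (fun t ht h => (le_abs_self _).trans (hdev t ht h) |> fun h' => by linarith) hsmall
  intro t ht
  have hd := hdev t ht (fun s hs => hup s ⟨hs.1, hs.2.trans ht.2⟩)
  have h1 := neg_abs_le (f t - a t)
  have h2 := le_abs_self (f t - a t)
  constructor
  · nlinarith
  · linarith

/-- **The clock (§10 l.98 with Q = 3/2, χ* = 2/(9C)).** Under the hypotheses of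
`floor_of_bootstrap` with `Q = 3/2`, at any time `t ∈ [0, T]` at which the linear prediction has
reached a level `a t ≤ χ* = 2/(9C)` (`C > 0`), the true perturbation has at least HALF that size:
`f t ≥ a t / 2`. So the perturbation provably reaches amplitude `χ*/2` no later than the linear
clock `t* = λ⁻¹ log(χ*/ε)` (the first time `a = χ*`), as long as `t* ≤ T`. -/
theorem half_prediction_le {f a : ℝ → ℝ} {T C : ℝ} (hC : 0 < C)
    (hf : ContinuousOn f (Icc 0 T)) (ha : ContinuousOn a (Icc 0 T))
    (h0 : f 0 ≤ (3 / 2 : ℝ) * a 0)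
    (hdev : ∀ t ∈ Icc 0 T, (∀ s ∈ Icc 0 t, f s ≤ (3 / 2 : ℝ) * a s) →
      |f t - a t| ≤ C * ((3 / 2 : ℝ) * a t) ^ 2)
    (hsmall : ∀ t ∈ Icc 0 T, 0 < a t ∧ C * (3 / 2 : ℝ) ^ 2 * a t < 3 / 2 - 1)
    {t : ℝ} (ht : t ∈ Icc 0 T) (hχ : a t ≤ 2 / (9 * C)) :
    a t / 2 ≤ f t := by
  have h := (floor_of_bootstrap hf ha h0 hdev hsmall t ht).1
  have hat : 0 < a t := (hsmall t ht).1
  have hkey : 1 / 2 ≤ 1 - C * (3 / 2 : ℝ) ^ 2 * a t := by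
    have : C * (3 / 2 : ℝ) ^ 2 * a t ≤ C * (3 / 2 : ℝ) ^ 2 * (2 / (9 * C)) :=
      mul_le_mul_of_nonneg_left hχ (by positivity)
    have e : C * (3 / 2 : ℝ) ^ 2 * (2 / (9 * C)) = 1 / 2 := by field_simp; ring
    linarith
  nlinarith

end Floor

end Summit.NavierStokesRegularity.FluidComputer.EmergenceBootstrap
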